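import Literature.NumberTheory.DiophantineGeometry.ShuteFourSquarefulQuadCount
import Literature.NumberTheory.Sieve.DivisorBound

/-!
# Shute (2021), §5: the weights `Δ(𝐲)^{3/4} |y₁y₂y₃y₄|^{-3/2+ε}` of Lemma 5.3 are summable, with tail `≪ D^{-1/4+ε}`

Fifth companion to `ShuteFourSquareful.lean` by this route (named fact
`Literature.NumberTheory.DiophantineGeometry.Shute2021_theorem11` = Theorem 1.1 of A. Shute,
*Sums of four squareful numbers*, arXiv:2104.06966), after `ShuteFourSquarefulMainCount.lean`
(§5 up to the point where Theorem 4.2 enters) and `ShuteFourSquarefulQuadCount.lean` (§4 notation: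
`N_𝐚(B)`, `Δ(𝐚)`, Lemma 4.13). Everything here is PROVED.

In §5 the main terms `𝔖_{𝐬²𝐲³} σ_∞(𝛆) B / (S|Y|^{3/2} s₀²)` of (5.7) are summed over all `𝐲`; with
Lemma 4.15 (`𝔖_𝐚 ≪ |A|^ε Δ(𝐚)^{1/4}`) and Lemma 4.13 (`Δ(𝐬²𝐲³) ≤ S⁴Δ(𝐲)³`) the `𝐲`-sum is
dominated by `Σ_𝐲 Δ(𝐲)^{3/4} |Y|^{-3/2+ε}`, and Lemma 5.3 is the tail estimate
`Σ_{Y > D} Δ(𝐲)^{3/4} Y^{-3/2+ε} ≪ D^{-1/4+ε}` ((5.8) and the display after it). This file proves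
that estimate in the following form (`Shute2021.weight θ 𝐲 = Δ(𝐲)^{3/4}|y₁y₂y₃y₄|^{θ−3/2}`, `θ` the
paper's `ε`):

* `Shute2021.exists_sum_weight_le`: for `θ < 1/4`, `Σ_{𝐲 ∈ s} w_θ(𝐲) ≤ C_θ` for every finite set
  `s ⊂ (ℤ_{≠0})⁴`;
* `Shute2021.exists_sum_weight_tail_le`: for `η ≥ 0`, `θ + η < 1/4`,
  `Σ_{𝐲 ∈ s, |Y| > D} w_θ(𝐲) ≤ C D^{-η}` (Rankin's trick `1_{|Y|>D} ≤ (|Y|/D)^η`), i.e. the printed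
  `≪ D^{-1/4+ε}`.

The paper obtains the bound by a dyadic decomposition in `M(𝐲) = Y/Δ(𝐲)` and `Δ(𝐲)`, using that
`Δ(𝐲)` is squareful ("there are `O(R^{1/2})` possible values for `Δ(𝐲)` in `[R, 2R]`") and that
`O((MΔ)^ε)` vectors `𝐲` share given `M, Δ`. The proof here is a reorganisation of the same two facts
that avoids dyadic ranges: split `|yᵢ| = uᵢvᵢ` with `vᵢ = gcd(|yᵢ|, ∏_{j≠i}|yⱼ|)`
(`Shute2021.sharedPart`, `Shute2021.privatePart`), so that `Δ(𝐲) = v₁v₂v₃v₄` by definition,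
`|Y| = UV` and `w_θ(𝐲) = U^{θ−3/2} V^{θ−3/4}` (`Shute2021.weight_eq_parts`); the map
`𝐲 ↦ (sgn 𝐲, 𝐮, 𝐯)` is injective (`Shute2021.parts_injective`), `Δ(𝐲)` is squareful for every
`𝐲 ∈ (ℤ_{≠0})⁴` (`Shute2021.isSquareful_delta`, from `ν_p(Δ) = Σᵢ min(ν_p(yᵢ), Σ_{j≠i}ν_p(yⱼ)) ≠ 1`),
hence the sum is at most `16 (Σ_n n^{θ−3/2})⁴ Σ_{𝐯 : ∏vᵢ squareful} (∏vᵢ)^{θ−3/4}`, and the last sum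
is bounded by grouping the `𝐯` by `P = ∏vᵢ = b³c²` (`≤ τ(P)³ ≤ C_δ³P^{3δ}` vectors per `P`, the
divisor bound of `Literature/NumberTheory/Sieve/DivisorBound.lean`) and
`Σ_{b,c} (b³c²)^{θ−3/4+3δ} < ∞` (`Shute2021.exists_sum_sqfull_le`).

## References

* A. Shute, *Sums of four squareful numbers*, arXiv:2104.06966v1 [math.NT] (2021), §5: (5.7),
  Lemma 5.3 (`E₁(D) ≪ D^{-1/4+ε}`) and its proof ((5.8), "`Δ(𝐲)` is always squareful", the dyadic
  count), Lemma 4.13 and Lemma 4.15 (the shape of the weights). [Shute2021]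
* G. H. Hardy, E. M. Wright, *An Introduction to the Theory of Numbers*, 6th ed. (OUP 2008),
  Thm 315 (divisor bound), as vendored in `Literature/NumberTheory/Sieve/DivisorBound.lean`.
  [HardyWright2008]
-/

noncomputable section

open Finset

namespace Literature.NumberTheory.DiophantineGeometry

namespace Shute2021

/-! ### `Δ(𝐲)` is squareful -/

/-- `ν_p(Δ(𝐚)) ≠ 1` for every prime `p` and every `𝐚 ∈ (ℤ_{≠0})⁴`: if some
`min(ν_p(aᵢ), Σ_{j≠i} ν_p(aⱼ)) ≥ 1` then a second index contributes as well ("we note that `Δ(𝐲)`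
is always squareful", proof of Lemma 5.3). [cite: Shute2021, §5, proof of Lemma 5.3] -/
theorem factorization_delta_ne_one {a : Fin 4 → ℤ} (ha : ∀ i, a i ≠ 0) (p : ℕ) :
    (delta a).factorization p ≠ 1 := by
  rw [factorization_delta ha]
  set e : Fin 4 → ℕ := fun i => (a i).natAbs.factorization p with he_def
  have he : ∀ i, (∑ j ∈ univ.erase i, e j) + e i = e 0 + e 1 + e 2 + e 3 := fun i => by
    rw [sum_erase_add _ _ (mem_univ i), Fin.sum_univ_four]
  have he0 : ∑ j ∈ univ.erase 0, e j = e 1 + e 2 + e 3 := by have := he 0; omega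
  have he1 : ∑ j ∈ univ.erase 1, e j = e 0 + e 2 + e 3 := by have := he 1; omega
  have he2 : ∑ j ∈ univ.erase 2, e j = e 0 + e 1 + e 3 := by have := he 2; omega
  have he3 : ∑ j ∈ univ.erase 3, e j = e 0 + e 1 + e 2 := by have := he 3; omega
  show ∑ i, min (e i) (∑ j ∈ univ.erase i, e j) ≠ 1
  rw [Fin.sum_univ_four, he0, he1, he2, he3]
  generalize e 0 = e0, e 1 = e1, e 2 = e2, e 3 = e3
  omega

/-- **`Δ(𝐚)` is squareful** for every `𝐚 ∈ (ℤ_{≠0})⁴` (all exponents of its factorization are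
`0` or `≥ 2`). [cite: Shute2021, §5, proof of Lemma 5.3 ("Δ(𝐲) is always squareful")] -/
theorem isSquareful_delta {a : Fin 4 → ℤ} (ha : ∀ i, a i ≠ 0) :
    IsSquareful (delta a : ℤ) := by
  rw [isSquareful_natCast_iff]
  refine ⟨(delta_pos ha).ne', fun p hp => ?_⟩
  have hpp : p.Prime := Nat.prime_of_mem_primeFactors hp
  rw [hpp.pow_dvd_iff_le_factorization (delta_pos ha).ne']
  have h1 : 1 ≤ (delta a).factorization p := by
    rw [← hpp.pow_dvd_iff_le_factorization (delta_pos ha).ne', pow_one]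
    exact Nat.dvd_of_mem_primeFactors hp
  have h2 := factorization_delta_ne_one ha p
  omega

/-- Hence `Δ(𝐚) = b³c²` with `b, c ≥ 1` (the decomposition of squareful numbers,
`exists_eq_pow_three_mul_sq_of_primeFactors`). In the proof of Lemma 5.3 this is "for any `R ≥ 1`
there are `O(R^{1/2})` possible values for `Δ(𝐲)` in `[R, 2R]`". [cite: Shute2021, §5, proof of
Lemma 5.3] -/
theorem exists_delta_eq_pow_three_mul_sq {a : Fin 4 → ℤ} (ha : ∀ i, a i ≠ 0) :
    ∃ b c : ℕ, 0 < b ∧ 0 < c ∧ delta a = b ^ 3 * c ^ 2 := by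
  obtain ⟨-, hpr⟩ := isSquareful_natCast_iff.1 (isSquareful_delta ha)
  obtain ⟨b, c, hb, hc, -, h⟩ := exists_eq_pow_three_mul_sq_of_primeFactors (delta_pos ha).ne' hpr
  exact ⟨b, c, hb, hc, h⟩

/-! ### The split `|yᵢ| = uᵢ vᵢ` into the private and the shared part -/

/-- The shared part `vᵢ = gcd(|yᵢ|, ∏_{j≠i} |yⱼ|)` of the coordinate `yᵢ` (the primes of `yᵢ`
dividing another coordinate, with multiplicity capped); `Δ(𝐲) = v₁v₂v₃v₄` by definition.
[folklore] -/
def sharedPart (y : Fin 4 → ℤ) (i : Fin 4) : ℕ :=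
  Nat.gcd (y i).natAbs (∏ j ∈ univ.erase i, (y j).natAbs)

/-- The private part `uᵢ = |yᵢ| / vᵢ`. [folklore] -/
def privatePart (y : Fin 4 → ℤ) (i : Fin 4) : ℕ := (y i).natAbs / sharedPart y i

/-- `Δ(𝐲) = ∏ᵢ vᵢ`. [folklore] -/
theorem delta_eq_prod_sharedPart (y : Fin 4 → ℤ) : delta y = ∏ i, sharedPart y i := rfl

/-- `vᵢ ∣ |yᵢ|`. [folklore] -/
theorem sharedPart_dvd (y : Fin 4 → ℤ) (i : Fin 4) : sharedPart y i ∣ (y i).natAbs :=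
  Nat.gcd_dvd_left _ _

/-- `uᵢ vᵢ = |yᵢ|`. [folklore] -/
theorem privatePart_mul_sharedPart (y : Fin 4 → ℤ) (i : Fin 4) :
    privatePart y i * sharedPart y i = (y i).natAbs :=
  Nat.div_mul_cancel (sharedPart_dvd y i)

/-- `vᵢ ≥ 1` for `yᵢ ≠ 0`. [folklore] -/
theorem sharedPart_pos {y : Fin 4 → ℤ} (hy : ∀ i, y i ≠ 0) (i : Fin 4) : 0 < sharedPart y i :=
  Nat.gcd_pos_of_pos_left _ (Int.natAbs_pos.2 (hy i))

/-- `uᵢ ≥ 1` for `yᵢ ≠ 0`. [folklore] -/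
theorem privatePart_pos {y : Fin 4 → ℤ} (hy : ∀ i, y i ≠ 0) (i : Fin 4) : 0 < privatePart y i := by
  have h := privatePart_mul_sharedPart y i
  rcases Nat.eq_zero_or_pos (privatePart y i) with h0 | h0
  · rw [h0, zero_mul] at h
    exact absurd h.symm (Int.natAbs_ne_zero.2 (hy i))
  · exact h0

/-- `uᵢ, vᵢ ≤ |yᵢ|`. [folklore] -/
theorem privatePart_le_and {y : Fin 4 → ℤ} (hy : ∀ i, y i ≠ 0) (i : Fin 4) :
    privatePart y i ≤ (y i).natAbs ∧ sharedPart y i ≤ (y i).natAbs := by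
  have h := privatePart_mul_sharedPart y i
  have hu := privatePart_pos hy i
  have hv := sharedPart_pos hy i
  constructor <;> nlinarith

/-- `|y₁y₂y₃y₄| = (∏ᵢ uᵢ)(∏ᵢ vᵢ) = (∏ᵢ uᵢ) Δ(𝐲)`. [folklore] -/
theorem natAbs_prod_eq_prod_mul_delta (y : Fin 4 → ℤ) :
    (∏ i, y i).natAbs = (∏ i, privatePart y i) * delta y := by
  rw [delta_eq_prod_sharedPart, ← prod_mul_distrib,
    show (∏ i, y i).natAbs = ∏ i, (y i).natAbs from map_prod Int.natAbsHom y univ]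
  exact prod_congr rfl fun i _ => (privatePart_mul_sharedPart y i).symm

/-- `yᵢ = sgn(yᵢ) · uᵢ · vᵢ`: the vector `𝐲` is recovered from its signs and its two parts.
[folklore] -/
theorem sign_mul_parts (y : Fin 4 → ℤ) (i : Fin 4) :
    (y i).sign * ((privatePart y i : ℕ) : ℤ) * ((sharedPart y i : ℕ) : ℤ) = y i := by
  rw [mul_assoc, ← Nat.cast_mul, privatePart_mul_sharedPart, Int.sign_mul_natAbs]

/-- The map `𝐲 ↦ (sgn 𝐲, 𝐮, 𝐯)`. [folklore] -/
def parts (y : Fin 4 → ℤ) : (Fin 4 → ℤ) × (Fin 4 → ℕ) × (Fin 4 → ℕ) :=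
  (fun i => (y i).sign, privatePart y, sharedPart y)

/-- `𝐲 ↦ (sgn 𝐲, 𝐮, 𝐯)` is injective. [folklore] -/
theorem parts_injective : Function.Injective parts := by
  intro y y' h
  simp only [parts, Prod.mk.injEq] at h
  obtain ⟨h1, h2, h3⟩ := h
  funext i
  rw [← sign_mul_parts y i, ← sign_mul_parts y' i, congrFun h1 i, congrFun h2 i, congrFun h3 i]

/-! ### The weights `Δ(𝐲)^{3/4} |y₁y₂y₃y₄|^{θ − 3/2}` -/

/-- The weight of `𝐲` in the main-term sums of §5: `w_θ(𝐲) = Δ(𝐲)^{3/4} |y₁y₂y₃y₄|^{θ−3/2}`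
(Lemma 5.3 bounds `Σ_{Y > D} Δ(𝐲)^{3/4} Y^{−3/2+ε}`; here `θ` is the paper's `ε`).
[cite: Shute2021, §5, proof of Lemma 5.3 (display after (5.8))] -/
def weight (θ : ℝ) (y : Fin 4 → ℤ) : ℝ :=
  (delta y : ℝ) ^ (3 / 4 : ℝ) * (((∏ i, y i).natAbs : ℕ) : ℝ) ^ (θ - 3 / 2)

/-- `w_θ(𝐲) ≥ 0`. [folklore] -/
theorem weight_nonneg (θ : ℝ) (y : Fin 4 → ℤ) : 0 ≤ weight θ y := by
  unfold weight; positivity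

/-- **The weight through the parts**: `w_θ(𝐲) = U^{θ−3/2} V^{θ−3/4}` with `U = ∏uᵢ`,
`V = ∏vᵢ = Δ(𝐲)` (since `|Y| = UV`). [folklore] -/
theorem weight_eq_parts (θ : ℝ) {y : Fin 4 → ℤ} (hy : ∀ i, y i ≠ 0) :
    weight θ y = ((∏ i, privatePart y i : ℕ) : ℝ) ^ (θ - 3 / 2) * (delta y : ℝ) ^ (θ - 3 / 4) := by
  have hV : (0 : ℝ) < delta y := by exact_mod_cast delta_pos hy
  have hU : (0 : ℝ) ≤ ((∏ i, privatePart y i : ℕ) : ℝ) := Nat.cast_nonneg _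
  unfold weight
  rw [natAbs_prod_eq_prod_mul_delta, Nat.cast_mul, Real.mul_rpow hU hV.le,
    show θ - 3 / 4 = 3 / 4 + (θ - 3 / 2) by ring, Real.rpow_add hV]
  ring

/-- `w_{θ+η}(𝐲) = w_θ(𝐲) |Y|^η`. [folklore] -/
theorem weight_add (θ η : ℝ) {y : Fin 4 → ℤ} (hy : ∀ i, y i ≠ 0) :
    weight (θ + η) y = weight θ y * (((∏ i, y i).natAbs : ℕ) : ℝ) ^ η := by
  have hY : (0 : ℝ) < (((∏ i, y i).natAbs : ℕ) : ℝ) := by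
    have : (∏ i, y i) ≠ 0 := prod_ne_zero_iff.2 fun i _ => hy i
    exact_mod_cast Int.natAbs_pos.2 this
  unfold weight
  rw [show θ + η - 3 / 2 = (θ - 3 / 2) + η by ring, Real.rpow_add hY]
  ring

/-! ### Summing the weights: `Σ_𝐲 w_θ(𝐲) ≤ C_θ` for `θ < 1/4` -/

/-- `Σ_{n ∈ T} n^{-s} ≤ 1 + Σ_{n ≥ 1} n^{-s}` for `s > 1` and every finite `T ⊂ ℕ`; we package the
constant. [folklore] -/
theorem exists_sum_rpow_neg_le {s : ℝ} (hs : 1 < s) :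
    ∃ Z : ℝ, 0 < Z ∧ ∀ T : Finset ℕ, ∑ n ∈ T, (n : ℝ) ^ (-s) ≤ Z := by
  have hsum : Summable fun n : ℕ => (n : ℝ) ^ (-s) := Real.summable_nat_rpow.2 (by linarith)
  refine ⟨∑' n : ℕ, (n : ℝ) ^ (-s) + 1, by positivity, fun T => ?_⟩
  have := hsum.sum_le_tsum T (fun n _ => by positivity)
  linarith

/-- The tail: for `s₁ > 1`, `s₂ ≥ 0` and `S > 0`, `Σ_{n ∈ T, n > S} n^{-(s₁+s₂)} ≤ Z_{s₁} S^{-s₂}`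
(`n^{-(s₁+s₂)} ≤ S^{-s₂} n^{-s₁}` for `n ≥ S`). [folklore] -/
theorem exists_sum_rpow_neg_tail_le {s₁ s₂ : ℝ} (hs₁ : 1 < s₁) (hs₂ : 0 ≤ s₂) :
    ∃ Z : ℝ, 0 < Z ∧ ∀ (T : Finset ℕ) (S : ℝ), 0 < S →
      ∑ n ∈ T with S < ((n : ℕ) : ℝ), ((n : ℕ) : ℝ) ^ (-(s₁ + s₂)) ≤ Z * S ^ (-s₂) := by
  obtain ⟨Z, hZ, hZle⟩ := exists_sum_rpow_neg_le hs₁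
  refine ⟨Z, hZ, fun T S hS => ?_⟩
  calc ∑ n ∈ T with S < ((n : ℕ) : ℝ), ((n : ℕ) : ℝ) ^ (-(s₁ + s₂))
      ≤ ∑ n ∈ T with S < ((n : ℕ) : ℝ), ((n : ℕ) : ℝ) ^ (-s₁) * S ^ (-s₂) := by
        refine sum_le_sum fun n hn => ?_
        have hSn : S < n := (mem_filter.1 hn).2
        have hn0 : (0 : ℝ) < n := hS.trans hSn
        rw [neg_add, Real.rpow_add hn0]
        refine mul_le_mul_of_nonneg_left ?_ (by positivity)
        exact Real.rpow_le_rpow_of_nonpos hS hSn.le (by linarith)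
    _ = (∑ n ∈ T with S < ((n : ℕ) : ℝ), ((n : ℕ) : ℝ) ^ (-s₁)) * S ^ (-s₂) := by rw [sum_mul]
    _ ≤ Z * S ^ (-s₂) := mul_le_mul_of_nonneg_right (hZle _) (by positivity)

/-- The number of `𝐯 ∈ [1, N]⁴` with `v₁v₂v₃v₄ = P` is at most `τ(P)³` (`v₁, v₂, v₃` are divisors of
`P` and determine `v₄`). [folklore] -/
theorem card_filter_prod_eq_le (N P : ℕ) (hP : P ≠ 0) :
    #{v ∈ Fintype.piFinset (fun _ : Fin 4 => Icc 1 N) | ∏ i, v i = P} ≤ #P.divisors ^ 3 := by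
  classical
  have h3 : #P.divisors ^ 3 = #(P.divisors ×ˢ P.divisors ×ˢ P.divisors) := by
    rw [card_product, card_product]; ring
  rw [h3]
  refine card_le_card_of_injOn (fun v => (v 0, v 1, v 2)) ?_ ?_
  · intro v hv
    rw [mem_coe, mem_filter] at hv
    obtain ⟨-, hvP⟩ := hv
    have hdv : ∀ i, v i ∣ P := fun i => by rw [← hvP]; exact dvd_prod_of_mem _ (mem_univ i)
    simp only [mem_coe, mem_product, Nat.mem_divisors]
    exact ⟨⟨hdv 0, hP⟩, ⟨hdv 1, hP⟩, ⟨hdv 2, hP⟩⟩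
  · intro v hv v' hv' h
    rw [mem_coe, mem_filter] at hv hv'
    simp only [Prod.mk.injEq] at h
    obtain ⟨h0, h1, h2⟩ := h
    have hp := hv.2.trans hv'.2.symm
    rw [Fin.prod_univ_four, Fin.prod_univ_four, h0, h1, h2] at hp
    have hpos : 0 < v' 0 * v' 1 * v' 2 := by
      have := hv'.2; rw [Fin.prod_univ_four] at this
      rcases Nat.eq_zero_or_pos (v' 0 * v' 1 * v' 2) with h | h
      · rw [h, zero_mul] at this; exact absurd this.symm hP
      · exact h
    have h3 : v 3 = v' 3 := Nat.eq_of_mul_eq_mul_left hpos hp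
    funext i
    fin_cases i <;> assumption

open Classical in
/-- **The sum over the squareful products.** For `θ < 1/4` there is `C` with
`Σ_{𝐯 ∈ [1,N]⁴, v₁v₂v₃v₄ squareful} (v₁v₂v₃v₄)^{θ − 3/4} ≤ C` for all `N`: group the vectors by
their product `P`, at most `τ(P)³ ≤ C_δ³P^{3δ}` of them per `P`, write each squareful `P` as `b³c²`
and use `Σ_{b,c ≥ 1} (b³c²)^{θ − 3/4 + 3δ} < ∞` (`θ + 3δ < 1/4`). This is the content of "there are
`O(R^{1/2})` possible values for `Δ(𝐲)` in the range `[R, 2R]`" in the proof of Lemma 5.3.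
[cite: Shute2021, §5, proof of Lemma 5.3] -/
theorem exists_sum_sqfull_le {θ : ℝ} (hθ : θ < 1 / 4) :
    ∃ C : ℝ, 0 < C ∧ ∀ N : ℕ,
      ∑ v ∈ (Fintype.piFinset fun _ : Fin 4 => Icc 1 N).filter
          (fun v => IsSquareful ((∏ i, v i : ℕ) : ℤ)),
        ((∏ i, v i : ℕ) : ℝ) ^ (θ - 3 / 4) ≤ C := by
  -- parameters
  set δ : ℝ := (1 / 4 - θ) / 6 with hδ
  have hδ0 : 0 < δ := by rw [hδ]; linarith
  set σ : ℝ := 3 / 4 - θ - 3 * δ with hσ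
  have h2σ : 1 < 2 * σ := by rw [hσ, hδ]; linarith
  have h3σ : 1 < 3 * σ := by rw [hσ, hδ]; linarith
  have hexp : θ - 3 / 4 = -σ - 3 * δ := by rw [hσ]; ring
  obtain ⟨Cd, hCd1, hCd⟩ := Literature.NumberTheory.Sieve.exists_card_divisors_le_mul_rpow hδ0
  obtain ⟨Z2, hZ2, hZ2le⟩ := exists_sum_rpow_neg_le h2σ
  obtain ⟨Z3, hZ3, hZ3le⟩ := exists_sum_rpow_neg_le h3σ
  refine ⟨Cd ^ 3 * (Z3 * Z2), by positivity, fun N => ?_⟩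
  set box := Fintype.piFinset fun _ : Fin 4 => Icc 1 N with hbox
  set V := box.filter (fun v => IsSquareful ((∏ i, v i : ℕ) : ℤ)) with hV
  set M := N ^ 4 with hM
  set T : Finset ℕ := (Icc 1 M).filter (fun P : ℕ => IsSquareful ((P : ℕ) : ℤ)) with hT
  have hmaps : ∀ v ∈ V, (∏ i, v i) ∈ T := by
    intro v hv
    rw [hV, mem_filter, hbox, Fintype.mem_piFinset] at hv
    obtain ⟨hvb, hsq⟩ := hv
    rw [hT, mem_filter, mem_Icc]
    refine ⟨⟨?_, ?_⟩, hsq⟩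
    · exact Nat.one_le_iff_ne_zero.2
        (prod_ne_zero_iff.2 fun i _ => by have := (mem_Icc.1 (hvb i)).1; omega)
    · calc ∏ i, v i ≤ ∏ _i : Fin 4, N := prod_le_prod' fun i _ => (mem_Icc.1 (hvb i)).2
        _ = M := by rw [prod_const, card_univ, Fintype.card_fin, hM]
  -- Step 1: fibre by fibre, `Σ_{v ∈ V} P(v)^{θ-3/4} ≤ Σ_{P ∈ T} Cd³ P^{-σ}`
  have hstep1 : ∑ v ∈ V, ((∏ i, v i : ℕ) : ℝ) ^ (θ - 3 / 4) ≤
      ∑ P ∈ T, Cd ^ 3 * (P : ℝ) ^ (-σ) := by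
    rw [← sum_fiberwise_of_maps_to hmaps]
    refine sum_le_sum fun P hP => ?_
    have hP0 : P ≠ 0 := by
      rw [hT, mem_filter, mem_Icc] at hP; omega
    have hPpos : (0 : ℝ) < P := by exact_mod_cast Nat.pos_of_ne_zero hP0
    -- the fibre sum is `#fibre · P^{θ-3/4}`
    have hfib : ∑ v ∈ V with ∏ i, v i = P, ((∏ i, v i : ℕ) : ℝ) ^ (θ - 3 / 4) =
        #{v ∈ V | ∏ i, v i = P} * (P : ℝ) ^ (θ - 3 / 4) := by
      rw [sum_congr rfl fun v hv => by rw [(mem_filter.1 hv).2], sum_const, nsmul_eq_mul]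
    rw [hfib]
    -- `#fibre ≤ τ(P)³ ≤ (Cd P^δ)³`
    have hcard : (#{v ∈ V | ∏ i, v i = P} : ℝ) ≤ (Cd * (P : ℝ) ^ δ) ^ 3 := by
      have h1 : #{v ∈ V | ∏ i, v i = P} ≤ #{v ∈ box | ∏ i, v i = P} :=
        card_le_card (filter_subset_filter _ (filter_subset _ _))
      have h2 := card_filter_prod_eq_le N P hP0
      have h3 : ((#P.divisors ^ 3 : ℕ) : ℝ) ≤ (Cd * (P : ℝ) ^ δ) ^ 3 := by
        push_cast
        exact pow_le_pow_left₀ (Nat.cast_nonneg _) (hCd P hP0) 3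
      calc (#{v ∈ V | ∏ i, v i = P} : ℝ) ≤ ((#P.divisors ^ 3 : ℕ) : ℝ) := by
            exact_mod_cast h1.trans h2
        _ ≤ _ := h3
    have hpow : (Cd * (P : ℝ) ^ δ) ^ 3 * (P : ℝ) ^ (θ - 3 / 4) = Cd ^ 3 * (P : ℝ) ^ (-σ) := by
      have e1 : ((P : ℝ) ^ δ) ^ 3 = (P : ℝ) ^ (3 * δ) := by
        rw [show ((P : ℝ) ^ δ) ^ 3 = ((P : ℝ) ^ δ) ^ ((3 : ℕ) : ℝ) from (Real.rpow_natCast _ 3).symm,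
          ← Real.rpow_mul hPpos.le]
        norm_num; ring_nf
      have e2 : (P : ℝ) ^ (3 * δ) * (P : ℝ) ^ (θ - 3 / 4) = (P : ℝ) ^ (-σ) := by
        rw [← Real.rpow_add hPpos, hexp]; ring_nf
      rw [mul_pow, e1, mul_assoc, e2]
    calc (#{v ∈ V | ∏ i, v i = P} : ℝ) * (P : ℝ) ^ (θ - 3 / 4)
        ≤ (Cd * (P : ℝ) ^ δ) ^ 3 * (P : ℝ) ^ (θ - 3 / 4) :=
          mul_le_mul_of_nonneg_right hcard (by positivity)
      _ = Cd ^ 3 * (P : ℝ) ^ (-σ) := hpow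
  -- Step 2: `T ⊆ {b³c² : b, c ≤ M}` and the double sum factors
  set I := Icc 1 M with hI
  have hsub : T ⊆ (I ×ˢ I).image (fun bc : ℕ × ℕ => bc.1 ^ 3 * bc.2 ^ 2) := by
    intro P hP
    rw [hT, mem_filter, mem_Icc] at hP
    obtain ⟨⟨hP1, hPM⟩, hsq⟩ := hP
    obtain ⟨-, hpr⟩ := isSquareful_natCast_iff.1 hsq
    obtain ⟨b, c, hb, hc, -, hbc⟩ := exists_eq_pow_three_mul_sq_of_primeFactors (by omega) hpr
    rw [mem_image]
    refine ⟨(b, c), ?_, hbc.symm⟩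
    rw [mem_product, hI, mem_Icc, mem_Icc]
    have hb3 : b ≤ b ^ 3 * c ^ 2 := by
      calc b ≤ b ^ 3 := Nat.le_self_pow (by norm_num) b
        _ ≤ b ^ 3 * c ^ 2 := Nat.le_mul_of_pos_right _ (by positivity)
    have hc2 : c ≤ b ^ 3 * c ^ 2 := by
      calc c ≤ c ^ 2 := Nat.le_self_pow (by norm_num) c
        _ ≤ b ^ 3 * c ^ 2 := Nat.le_mul_of_pos_left _ (by positivity)
    exact ⟨⟨hb, by omega⟩, ⟨hc, by omega⟩⟩
  have hstep2 : ∑ P ∈ T, (P : ℝ) ^ (-σ) ≤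
      ∑ bc ∈ I ×ˢ I, (((bc.1 ^ 3 * bc.2 ^ 2 : ℕ) : ℕ) : ℝ) ^ (-σ) := by
    refine (sum_le_sum_of_subset_of_nonneg hsub fun P _ _ => by positivity).trans ?_
    exact sum_image_le_of_nonneg fun bc _ => by positivity
  have key : ∀ b c : ℕ, (((b ^ 3 * c ^ 2 : ℕ) : ℕ) : ℝ) ^ (-σ) =
      (b : ℝ) ^ (-(3 * σ)) * (c : ℝ) ^ (-(2 * σ)) := by
    intro b c
    have hb0 : (0 : ℝ) ≤ b := Nat.cast_nonneg _
    have hc0 : (0 : ℝ) ≤ c := Nat.cast_nonneg _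
    have e1 : ((b : ℝ) ^ 3) ^ (-σ) = (b : ℝ) ^ (-(3 * σ)) := by
      rw [show (b : ℝ) ^ 3 = (b : ℝ) ^ ((3 : ℕ) : ℝ) from (Real.rpow_natCast _ 3).symm,
        ← Real.rpow_mul hb0]
      norm_num
    have e2 : ((c : ℝ) ^ 2) ^ (-σ) = (c : ℝ) ^ (-(2 * σ)) := by
      rw [show (c : ℝ) ^ 2 = (c : ℝ) ^ ((2 : ℕ) : ℝ) from (Real.rpow_natCast _ 2).symm,
        ← Real.rpow_mul hc0]
      norm_num
    push_cast
    rw [Real.mul_rpow (by positivity) (by positivity), e1, e2]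
  have hstep3 : ∑ bc ∈ I ×ˢ I, (((bc.1 ^ 3 * bc.2 ^ 2 : ℕ) : ℕ) : ℝ) ^ (-σ) =
      (∑ b ∈ I, (b : ℝ) ^ (-(3 * σ))) * ∑ c ∈ I, (c : ℝ) ^ (-(2 * σ)) := by
    rw [sum_mul_sum, sum_product]
    exact sum_congr rfl fun b _ => sum_congr rfl fun c _ => key b c
  calc ∑ v ∈ V, ((∏ i, v i : ℕ) : ℝ) ^ (θ - 3 / 4)
      ≤ ∑ P ∈ T, Cd ^ 3 * (P : ℝ) ^ (-σ) := hstep1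
    _ = Cd ^ 3 * ∑ P ∈ T, (P : ℝ) ^ (-σ) := by rw [mul_sum]
    _ ≤ Cd ^ 3 * ((∑ b ∈ I, (b : ℝ) ^ (-(3 * σ))) * ∑ c ∈ I, (c : ℝ) ^ (-(2 * σ))) := by
        rw [← hstep3]; exact mul_le_mul_of_nonneg_left hstep2 (by positivity)
    _ ≤ Cd ^ 3 * (Z3 * Z2) := by
        refine mul_le_mul_of_nonneg_left ?_ (by positivity)
        exact mul_le_mul (hZ3le I) (hZ2le I) (sum_nonneg fun c _ => by positivity) hZ3.le

/-- The sign vectors `{±1}⁴`. [folklore] -/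
theorem card_signs : #(Fintype.piFinset fun _ : Fin 4 => ({-1, 1} : Finset ℤ)) = 16 := by
  rw [Fintype.card_piFinset]; decide

/-- The sign of a nonzero integer is `±1`. [folklore] -/
theorem sign_mem_of_ne_zero {z : ℤ} (hz : z ≠ 0) : z.sign ∈ ({-1, 1} : Finset ℤ) := by
  rcases lt_or_gt_of_ne hz with h | h
  · simp [Int.sign_eq_neg_one_of_neg h]
  · simp [Int.sign_eq_one_of_pos h]

open Classical in
/-- **Summing the weights (the convergent part of Lemma 5.3).** For `θ < 1/4` there is `C_θ` such
that `Σ_{𝐲 ∈ s} Δ(𝐲)^{3/4}|y₁y₂y₃y₄|^{θ−3/2} ≤ C_θ` for every finite set `s` of vectors with nonzero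
coordinates: through `𝐲 ↦ (sgn 𝐲, 𝐮, 𝐯)` (injective) and `w_θ = U^{θ−3/2}V^{θ−3/4}` the sum is at
most `16 · (Σ_n n^{θ−3/2})⁴ · Σ_{𝐯, ∏vᵢ squareful} (∏vᵢ)^{θ−3/4}`. (The paper sums over dyadic ranges
of `M(𝐲) = Y/Δ(𝐲)` and `Δ(𝐲)`.) [cite: Shute2021, §5, proof of Lemma 5.3] -/
theorem exists_sum_weight_le {θ : ℝ} (hθ : θ < 1 / 4) :
    ∃ C : ℝ, 0 < C ∧ ∀ s : Finset (Fin 4 → ℤ), (∀ y ∈ s, ∀ i, y i ≠ 0) →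
      ∑ y ∈ s, weight θ y ≤ C := by
  have h1 : 1 < 3 / 2 - θ := by linarith
  obtain ⟨Z1, hZ1, hZ1le⟩ := exists_sum_rpow_neg_le h1
  obtain ⟨C2, hC2, hC2le⟩ := exists_sum_sqfull_le hθ
  refine ⟨16 * Z1 ^ 4 * C2, by positivity, fun s hs => ?_⟩
  -- a common bound for the coordinates
  set N : ℕ := s.sup fun y => univ.sup fun i => (y i).natAbs with hN
  have hyN : ∀ y ∈ s, ∀ i, (y i).natAbs ≤ N := fun y hy i =>
    (Finset.le_sup (f := fun i => (y i).natAbs) (mem_univ i)).trans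
      (Finset.le_sup (f := fun y => univ.sup fun i => (y i).natAbs) hy)
  -- the target sets
  set Sg := Fintype.piFinset fun _ : Fin 4 => ({-1, 1} : Finset ℤ) with hSg
  set box := Fintype.piFinset fun _ : Fin 4 => Icc 1 N with hbox
  set V := box.filter (fun v => IsSquareful ((∏ i, v i : ℕ) : ℤ)) with hV
  set G : (Fin 4 → ℤ) × (Fin 4 → ℕ) × (Fin 4 → ℕ) → ℝ := fun t =>
    ((∏ i, t.2.1 i : ℕ) : ℝ) ^ (θ - 3 / 2) * ((∏ i, t.2.2 i : ℕ) : ℝ) ^ (θ - 3 / 4) with hG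
  have hG0 : ∀ t, 0 ≤ G t := fun t => by rw [hG]; positivity
  -- `weight θ y = G (parts y)` on `s`
  have hwG : ∀ y ∈ s, weight θ y = G (parts y) := fun y hy => by
    rw [weight_eq_parts θ (hs y hy), hG]
    simp only [parts, delta_eq_prod_sharedPart]
  -- `parts` maps `s` into `Sg × box × V`
  have hmaps : s.image parts ⊆ Sg ×ˢ (box ×ˢ V) := by
    intro t ht
    rw [mem_image] at ht
    obtain ⟨y, hy, rfl⟩ := ht
    have hy0 := hs y hy
    simp only [parts, mem_product, hSg, hbox, hV, Fintype.mem_piFinset, mem_filter, mem_Icc]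
    refine ⟨fun i => sign_mem_of_ne_zero (hy0 i), fun i => ⟨privatePart_pos hy0 i,
      (privatePart_le_and hy0 i).1.trans (hyN y hy i)⟩, fun i => ⟨sharedPart_pos hy0 i,
      (privatePart_le_and hy0 i).2.trans (hyN y hy i)⟩, ?_⟩
    rw [← delta_eq_prod_sharedPart]
    exact isSquareful_delta hy0
  -- the sum over the product set factors
  have hfactor : ∑ t ∈ Sg ×ˢ (box ×ˢ V), G t =
      16 * ((∑ u ∈ box, ((∏ i, u i : ℕ) : ℝ) ^ (θ - 3 / 2)) *
        ∑ v ∈ V, ((∏ i, v i : ℕ) : ℝ) ^ (θ - 3 / 4)) := by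
    rw [sum_product, hG]
    simp only
    rw [sum_const, card_signs, nsmul_eq_mul, Nat.cast_ofNat, sum_product, sum_mul_sum]
  -- the `u`-sum is a fourth power
  have hu : ∑ u ∈ box, ((∏ i, u i : ℕ) : ℝ) ^ (θ - 3 / 2) =
      (∑ n ∈ Icc 1 N, (n : ℝ) ^ (θ - 3 / 2)) ^ 4 := by
    have : ∀ u ∈ box, ((∏ i, u i : ℕ) : ℝ) ^ (θ - 3 / 2) = ∏ i, ((u i : ℕ) : ℝ) ^ (θ - 3 / 2) :=
      fun u _ => by
        rw [Nat.cast_prod, Real.finsetProd_rpow _ _ (fun i _ => Nat.cast_nonneg _)]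
    rw [sum_congr rfl this, hbox, ← prod_univ_sum (fun _ : Fin 4 => Icc 1 N)
      (fun _ n => ((n : ℕ) : ℝ) ^ (θ - 3 / 2)), prod_const, card_univ, Fintype.card_fin]
  have hu' : (∑ n ∈ Icc 1 N, (n : ℝ) ^ (θ - 3 / 2)) ^ 4 ≤ Z1 ^ 4 := by
    refine pow_le_pow_left₀ (sum_nonneg fun n _ => by positivity) ?_ 4
    have := hZ1le (Icc 1 N)
    rwa [show -(3 / 2 - θ) = θ - 3 / 2 by ring] at this
  calc ∑ y ∈ s, weight θ y = ∑ y ∈ s, G (parts y) := sum_congr rfl hwG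
    _ = ∑ t ∈ s.image parts, G t := (sum_image fun y _ y' _ h => parts_injective h).symm
    _ ≤ ∑ t ∈ Sg ×ˢ (box ×ˢ V), G t := sum_le_sum_of_subset_of_nonneg hmaps fun t _ _ => hG0 t
    _ = 16 * ((∑ u ∈ box, ((∏ i, u i : ℕ) : ℝ) ^ (θ - 3 / 2)) *
          ∑ v ∈ V, ((∏ i, v i : ℕ) : ℝ) ^ (θ - 3 / 4)) := hfactor
    _ ≤ 16 * (Z1 ^ 4 * C2) := by
        rw [hu]
        refine mul_le_mul_of_nonneg_left ?_ (by norm_num)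
        exact mul_le_mul hu' (hC2le N) (sum_nonneg fun v _ => by positivity) (by positivity)
    _ = 16 * Z1 ^ 4 * C2 := by ring

/-- **The tail of the weights (Lemma 5.3 of Shute (2021), `E₁(D) ≪ D^{-1/4+ε}`, in the form used
here).** For `η ≥ 0` and `θ + η < 1/4` there is `C` such that
`Σ_{𝐲 ∈ s, |y₁y₂y₃y₄| > D} Δ(𝐲)^{3/4}|Y|^{θ−3/2} ≤ C D^{−η}` for every finite set `s` of vectors with
nonzero coordinates and every `D > 0` (Rankin's trick: `1_{|Y| > D} ≤ (|Y|/D)^η`).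
[cite: Shute2021, Lemma 5.3] -/
theorem exists_sum_weight_tail_le {θ η : ℝ} (hη : 0 ≤ η) (h : θ + η < 1 / 4) :
    ∃ C : ℝ, 0 < C ∧ ∀ s : Finset (Fin 4 → ℤ), (∀ y ∈ s, ∀ i, y i ≠ 0) → ∀ D : ℝ, 0 < D →
      ∑ y ∈ s with D < (((∏ i, y i).natAbs : ℕ) : ℝ), weight θ y ≤ C * D ^ (-η) := by
  obtain ⟨C, hC, hCle⟩ := exists_sum_weight_le h
  refine ⟨C, hC, fun s hs D hD => ?_⟩
  have hs' : ∀ y ∈ s.filter (fun y => D < (((∏ i, y i).natAbs : ℕ) : ℝ)), ∀ i, y i ≠ 0 :=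
    fun y hy => hs y (mem_filter.1 hy).1
  calc ∑ y ∈ s with D < (((∏ i, y i).natAbs : ℕ) : ℝ), weight θ y
      ≤ ∑ y ∈ s with D < (((∏ i, y i).natAbs : ℕ) : ℝ), weight (θ + η) y * D ^ (-η) := by
        refine sum_le_sum fun y hy => ?_
        obtain ⟨hys, hyD⟩ := mem_filter.1 hy
        have hy0 := hs y hys
        rw [weight_add θ η hy0, mul_assoc]
        have hYD : (((∏ i, y i).natAbs : ℕ) : ℝ) ^ η * D ^ (-η) ≥ 1 := by
          rw [Real.rpow_neg hD.le, ← div_eq_mul_inv, ge_iff_le, one_le_div (Real.rpow_pos_of_pos hD η)]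
          exact Real.rpow_le_rpow hD.le hyD.le hη
        exact le_mul_of_one_le_right (weight_nonneg θ y) hYD
    _ = (∑ y ∈ s with D < (((∏ i, y i).natAbs : ℕ) : ℝ), weight (θ + η) y) * D ^ (-η) := by
        rw [sum_mul]
    _ ≤ C * D ^ (-η) := by
        refine mul_le_mul_of_nonneg_right ?_ (by positivity)
        exact (sum_le_sum_of_subset_of_nonneg (filter_subset _ s)
          (fun y _ _ => weight_nonneg _ y)).trans (hCle s hs)

end Shute2021

end Literature.NumberTheory.DiophantineGeometry
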